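import Mathlib

/-!
HONEST FRAMING: exact (Metropolis-corrected) sampling algorithms for lattice gauge theory; figures
of merit are autocorrelation/cost numbers at stated couplings and volumes; no continuum-physics
claim.

# ResolventLaw — THE GEOMETRIC RESOLVENT OF A STOCHASTIC MATRIX: THE LAW OF A CHAIN STOPPED AFTER A GEOMETRIC NUMBER OF STEPS, ITS POSITIVITY, UNIQUENESS, TAIL LAW,
# SUPPORT, AND THE SUB-SOLUTION PRINCIPLE `V ≤ (1−σ)f + σ·KV ⇒ E_u f ≥ E_ν V` (lean-2 GEN-36, ours)

Venture-side (OURS).  Cell `lqcd-flow` (pub-lqcd), unit `pub-lqcd-lean-2-g36`, 2026-08-29.  Chapter W (item 1 (i) of `lean-2/OPEN-MATH-chapterM.md` at FINITE swap odds, in the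
composition variables of chapter V), file 1: the generic tool.  In the homogeneous `q`-content star with swap fraction `t` and hub refresh rate `h = (1−t)w_0`, a refresh cycle
contains a geometric number of swap attempts, `P(n) = (1−σ)σⁿ` with `σ = τ/(1+τ)`, `τ = t/h`; the content deleted at the end of the cycle is therefore distributed by the
GEOMETRIC RESOLVENT `u = (1−σ)·Σ_n σⁿ ν Kⁿ` of the one-copy hub chain `K = K_N` (`Scaling/HubChainDetailedBalance`) started from `ν = δ_z`.  This file treats `u` for an
arbitrary stochastic matrix `K` on a finite type through its defining equation `u = (1−σ)ν + σ·uK` (`0 ≤ σ < 1`; hypothesis-equation, no series, no inverse): the solution is a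
probability vector (`geomResolvent_nonneg`, `geomResolvent_sum`), unique (`geomResolvent_unique`), supported on any `K`-closed set carrying `ν` (`geomResolvent_support_subset`),
decomposes as `u = (1−σ)ν + σũ` with the TAIL LAW `ũ = uK` again a resolvent (from `νK`; `geomResolvent_tail`), and — the working tool for the finite-`τ` end-hub estimates —
satisfies the SUB-SOLUTION PRINCIPLE: if `V ≤ (1−σ)f + σ·KV` pointwise then `E_ν V ≤ E_u f` (`geomResolvent_expect_ge_of_subsolution`; super-solutions bound from above;
corollaries: constants, and the drift form `f − Kf ≤ d ⇒ E_u f ≥ E_ν f − σd/(1−σ)`, i.e. at most `τ = σ/(1−σ)` expected steps of drift).  Applied on a product type to a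
Markovian coupling of two hub chains it bounds two-copy functionals of the pair of end-hub laws (file `ResolventPairCoupling`).  Hypothesis-equations throughout, no definitions.

## What is proved

* §1 `geomResolvent_sum`, `geomResolvent_nonneg`, `geomResolvent_le_one`, `geomResolvent_unique`, `geomResolvent_support_subset`.
* §2 `geomResolvent_tail_eq`, `geomResolvent_tail_nonneg`, `geomResolvent_tail_sum`, `geomResolvent_decomp`.
* §3 **`geomResolvent_expect_ge_of_subsolution`**, **`geomResolvent_expect_le_of_supersolution`**, `geomResolvent_expect_ge_const`, `geomResolvent_expect_le_const`,
  **`geomResolvent_expect_ge_of_drift`**, `geomResolvent_expect_le_of_drift`, `geomResolvent_expect_eq_of_harmonic`.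

Reading (no numerics implied): with `K = K_N` and `ν = δ_z` this is the end-hub law `u_(z,N)` of MEMO-gen35 §5/§7 at every swap rate; `σ = 0` is one deletion of the hub
content, `σ → 1` the urn.  NOT CLAIMED: anything about the star.  Literature grade (cell rule): OWN, elementary (a discounted Poisson inequality for finite chains); nothing
cited as a fact; no new bib keys.
-/

open Finset

namespace Summit.Ventures.LatticeQCDFlow.Scaling

section Resolvent
variable {S : Type*} [Fintype S]
variable {K : S → S → ℝ} {σ : ℝ} {ν u : S → ℝ}

/-! ## §1 The solution of `u = (1−σ)ν + σ·uK` is a probability vector, unique, with controlled support -/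

/-- Exchange of the order of summation in `Σ_v (Σ_h u_h K_{hv}) g_v = Σ_h u_h Σ_v K_{hv} g_v`. [ours] -/
theorem geomResolvent_sum_swap (u g : S → ℝ) (K : S → S → ℝ) :
    ∑ v, (∑ h, u h * K h v) * g v = ∑ h, u h * ∑ v, K h v * g v := by
  simp_rw [Finset.sum_mul, Finset.mul_sum]
  rw [Finset.sum_comm]
  exact sum_congr rfl fun h _ => sum_congr rfl fun v _ => by ring

/-- Mass transport: `Σ_v Σ_h u_h K_{hv} = Σ_h u_h` when the rows of `K` sum to one. [ours] -/
theorem geomResolvent_mass_K (hK1 : ∀ a, ∑ b, K a b = 1) (u : S → ℝ) : ∑ v, ∑ h, u h * K h v = ∑ h, u h := by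
  rw [Finset.sum_comm]
  exact sum_congr rfl fun h _ => by rw [← mul_sum, hK1, mul_one]

/-- **Total mass:** if the rows of `K` sum to one and `σ ≠ 1`, the solution of `u = (1−σ)ν + σ·uK` has `Σ u = Σ ν`. [ours] -/
theorem geomResolvent_sum (hK1 : ∀ a, ∑ b, K a b = 1) (hσ1 : σ ≠ 1)
    (hu : ∀ v, u v = (1 - σ) * ν v + σ * ∑ h, u h * K h v) : ∑ v, u v = ∑ v, ν v := by
  have h1 : ∑ v, u v = (1 - σ) * ∑ v, ν v + σ * ∑ v, u v := by
    calc ∑ v, u v = ∑ v, ((1 - σ) * ν v + σ * ∑ h, u h * K h v) := sum_congr rfl fun v _ => hu v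
      _ = (1 - σ) * ∑ v, ν v + σ * ∑ v, ∑ h, u h * K h v := by rw [sum_add_distrib, ← mul_sum, ← mul_sum]
      _ = (1 - σ) * ∑ v, ν v + σ * ∑ v, u v := by rw [geomResolvent_mass_K hK1]
  have hσ : (1 - σ) ≠ 0 := sub_ne_zero.mpr (Ne.symm hσ1)
  have h2 : (1 - σ) * ∑ v, u v = (1 - σ) * ∑ v, ν v := by linarith
  exact mul_left_cancel₀ hσ h2

/-- **Non-negativity:** `K ≥ 0` with row sums one, `0 ≤ σ < 1`, `ν ≥ 0` ⇒ the solution of `u = (1−σ)ν + σ·uK` is non-negative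
(the total negative mass `T` satisfies `T ≤ σT`). [ours] -/
theorem geomResolvent_nonneg (hK0 : ∀ a b, 0 ≤ K a b) (hK1 : ∀ a, ∑ b, K a b = 1) (hσ0 : 0 ≤ σ) (hσ1 : σ < 1)
    (hν0 : ∀ v, 0 ≤ ν v) (hu : ∀ v, u v = (1 - σ) * ν v + σ * ∑ h, u h * K h v) (v : S) : 0 ≤ u v := by
  -- negative parts `m w = max (-u w) 0`
  set m : S → ℝ := fun w => max (-u w) 0 with hm
  have hm0 : ∀ w, 0 ≤ m w := fun w => le_max_right _ _
  have hmu : ∀ w, -u w ≤ m w := fun w => le_max_left _ _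
  -- pointwise: `m v ≤ σ Σ_h m h K h v`
  have hpt : ∀ w, m w ≤ σ * ∑ h, m h * K h w := by
    intro w
    have hrhs : 0 ≤ σ * ∑ h, m h * K h w := mul_nonneg hσ0 (sum_nonneg fun h _ => mul_nonneg (hm0 h) (hK0 h w))
    refine max_le ?_ hrhs
    rw [hu w]
    have h1 : -(σ * ∑ h, u h * K h w) ≤ σ * ∑ h, m h * K h w := by
      rw [← mul_neg, ← sum_neg_distrib]
      exact mul_le_mul_of_nonneg_left (sum_le_sum fun h _ => by
        rw [← neg_mul]; exact mul_le_mul_of_nonneg_right (hmu h) (hK0 h w)) hσ0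
    have h2 : 0 ≤ (1 - σ) * ν w := mul_nonneg (by linarith) (hν0 w)
    linarith
  -- sum: `T ≤ σ T`
  have hT : ∑ w, m w ≤ σ * ∑ w, m w := by
    calc ∑ w, m w ≤ ∑ w, σ * ∑ h, m h * K h w := sum_le_sum fun w _ => hpt w
      _ = σ * ∑ w, ∑ h, m h * K h w := by rw [mul_sum]
      _ = σ * ∑ w, m w := by rw [geomResolvent_mass_K hK1]
  have hT0 : 0 ≤ ∑ w, m w := sum_nonneg fun w _ => hm0 w
  have hTz : ∑ w, m w = 0 := by nlinarith
  have hmz : m v = 0 := (sum_eq_zero_iff_of_nonneg fun w _ => hm0 w).mp hTz v (mem_univ v)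
  have := hmu v
  rw [hmz] at this
  linarith

/-- Each entry of the solution is at most the total initial mass: `u v ≤ Σ ν`. [ours] -/
theorem geomResolvent_le_sum (hK0 : ∀ a b, 0 ≤ K a b) (hK1 : ∀ a, ∑ b, K a b = 1) (hσ0 : 0 ≤ σ) (hσ1 : σ < 1)
    (hν0 : ∀ v, 0 ≤ ν v) (hu : ∀ v, u v = (1 - σ) * ν v + σ * ∑ h, u h * K h v) (v : S) : u v ≤ ∑ w, ν w := by
  rw [← geomResolvent_sum hK1 (ne_of_lt hσ1) hu]
  exact single_le_sum (fun w _ => geomResolvent_nonneg hK0 hK1 hσ0 hσ1 hν0 hu w) (mem_univ v)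

/-- **Uniqueness:** two solutions of `u = (1−σ)ν + σ·uK` coincide (`K ≥ 0`, row sums one, `0 ≤ σ < 1`): the `ℓ¹` mass `D` of the difference has `D ≤ σD`. [ours] -/
theorem geomResolvent_unique (hK0 : ∀ a b, 0 ≤ K a b) (hK1 : ∀ a, ∑ b, K a b = 1) (hσ0 : 0 ≤ σ) (hσ1 : σ < 1) {u u' : S → ℝ}
    (hu : ∀ v, u v = (1 - σ) * ν v + σ * ∑ h, u h * K h v) (hu' : ∀ v, u' v = (1 - σ) * ν v + σ * ∑ h, u' h * K h v) : u = u' := by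
  -- the difference solves the equation with `ν = 0`; apply non-negativity to `d` and `−d`
  have hd : ∀ v, (u v - u' v) = (1 - σ) * (0 : ℝ) + σ * ∑ h, (u h - u' h) * K h v := by
    intro v; rw [hu v, hu' v]; simp_rw [sub_mul]; rw [sum_sub_distrib]; ring
  have hd' : ∀ v, (u' v - u v) = (1 - σ) * (0 : ℝ) + σ * ∑ h, (u' h - u h) * K h v := by
    intro v; rw [hu v, hu' v]; simp_rw [sub_mul]; rw [sum_sub_distrib]; ring
  funext v
  have h1 : 0 ≤ u v - u' v := geomResolvent_nonneg (ν := fun _ => 0) (u := fun w => u w - u' w) hK0 hK1 hσ0 hσ1 (fun _ => le_rfl) hd v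
  have h2 : 0 ≤ u' v - u v := geomResolvent_nonneg (ν := fun _ => 0) (u := fun w => u' w - u w) hK0 hK1 hσ0 hσ1 (fun _ => le_rfl) hd' v
  linarith

/-- **Support:** if `ν` vanishes off a set `G` of states that `K` does not leave (`K(h,v) = 0` for `h ∈ G`, `v ∉ G`), then the solution vanishes off `G`
(`K ≥ 0`, rows one, `0 ≤ σ < 1`). [ours] -/
theorem geomResolvent_support_subset (hK0 : ∀ a b, 0 ≤ K a b) (hK1 : ∀ a, ∑ b, K a b = 1) (hσ0 : 0 ≤ σ) (hσ1 : σ < 1)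
    (hu : ∀ v, u v = (1 - σ) * ν v + σ * ∑ h, u h * K h v) (G : S → Prop) [DecidablePred G]
    (hνG : ∀ v, ¬ G v → ν v = 0) (hKG : ∀ h v, G h → ¬ G v → K h v = 0) (v : S) (hv : ¬ G v) : u v = 0 := by
  classical
  -- absolute values off `G`: `a w = |u w|` for `w ∉ G`, `0` on `G`
  set a : S → ℝ := fun w => if G w then 0 else |u w| with ha
  have ha0 : ∀ w, 0 ≤ a w := fun w => by
    by_cases hw : G w
    · simp [ha, hw]
    · simp [ha, hw, abs_nonneg]
  have hpt : ∀ w, a w ≤ σ * ∑ h, a h * K h w := by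
    intro w
    by_cases hw : G w
    · simp only [ha, hw, if_true]
      exact mul_nonneg hσ0 (sum_nonneg fun h _ => mul_nonneg (ha0 h) (hK0 h w))
    · simp only [ha, hw, if_false]
      rw [hu w, hνG w hw, mul_zero, zero_add, abs_mul, abs_of_nonneg hσ0]
      refine mul_le_mul_of_nonneg_left ((abs_sum_le_sum_abs _ _).trans (sum_le_sum fun h _ => ?_)) hσ0
      by_cases hh : G h
      · simp [hKG h w hh hw]
      · rw [abs_mul, abs_of_nonneg (hK0 h w)]; simp [hh]
  have hT : ∑ w, a w ≤ σ * ∑ w, a w := by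
    calc ∑ w, a w ≤ ∑ w, σ * ∑ h, a h * K h w := sum_le_sum fun w _ => hpt w
      _ = σ * ∑ w, a w := by rw [← mul_sum, geomResolvent_mass_K hK1]
  have hT0 : 0 ≤ ∑ w, a w := sum_nonneg fun w _ => ha0 w
  have hTz : ∑ w, a w = 0 := by nlinarith
  have haz : a v = 0 := (sum_eq_zero_iff_of_nonneg fun w _ => ha0 w).mp hTz v (mem_univ v)
  simp only [ha, hv, if_false, abs_eq_zero] at haz
  exact haz

/-! ## §2 The tail law `ũ = uK` -/

/-- **The tail law solves the resolvent equation from `νK`:** with `ũ v = Σ_h u h K h v`, `ũ = (1−σ)(νK) + σ·ũK`. [ours] -/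
theorem geomResolvent_tail_eq (hu : ∀ v, u v = (1 - σ) * ν v + σ * ∑ h, u h * K h v) {ut : S → ℝ} (hut : ∀ v, ut v = ∑ h, u h * K h v) (v : S) :
    ut v = (1 - σ) * (∑ h, ν h * K h v) + σ * ∑ h, ut h * K h v := by
  rw [hut v]
  calc ∑ h, u h * K h v = ∑ h, ((1 - σ) * ν h + σ * ∑ w, u w * K w h) * K h v := sum_congr rfl fun h _ => by rw [hu h]
    _ = (1 - σ) * ∑ h, ν h * K h v + σ * ∑ h, (∑ w, u w * K w h) * K h v := by
        simp_rw [add_mul, sum_add_distrib, mul_assoc, ← mul_sum]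
    _ = (1 - σ) * (∑ h, ν h * K h v) + σ * ∑ h, ut h * K h v := by
        congr 1; congr 1; exact sum_congr rfl fun h _ => by rw [hut h]

/-- The decomposition `u = (1−σ)ν + σũ`. [ours] -/
theorem geomResolvent_decomp (hu : ∀ v, u v = (1 - σ) * ν v + σ * ∑ h, u h * K h v) {ut : S → ℝ} (hut : ∀ v, ut v = ∑ h, u h * K h v) (v : S) :
    u v = (1 - σ) * ν v + σ * ut v := by rw [hu v, hut v]

/-- The tail law is non-negative when `u` and `K` are. [ours] -/
theorem geomResolvent_tail_nonneg (hK0 : ∀ a b, 0 ≤ K a b) (hu0 : ∀ v, 0 ≤ u v) {ut : S → ℝ} (hut : ∀ v, ut v = ∑ h, u h * K h v) (v : S) : 0 ≤ ut v := by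
  rw [hut]; exact sum_nonneg fun h _ => mul_nonneg (hu0 h) (hK0 h v)

/-- The tail law has the mass of `u`. [ours] -/
theorem geomResolvent_tail_sum (hK1 : ∀ a, ∑ b, K a b = 1) {ut : S → ℝ} (hut : ∀ v, ut v = ∑ h, u h * K h v) : ∑ v, ut v = ∑ v, u v := by
  simp_rw [hut]
  exact geomResolvent_mass_K hK1 u

/-! ## §3 The sub-solution and super-solution principles -/

/-- **SUB-SOLUTION PRINCIPLE.**  `u ≥ 0` solving `u = (1−σ)ν + σ·uK` with `σ < 1`; if `V ≤ (1−σ)·f + σ·KV` pointwise then `Σ ν V ≤ Σ u f`. [ours] -/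
theorem geomResolvent_expect_ge_of_subsolution (hσ1 : σ < 1) (hu : ∀ v, u v = (1 - σ) * ν v + σ * ∑ h, u h * K h v) (hu0 : ∀ v, 0 ≤ u v)
    {f V : S → ℝ} (hV : ∀ v, V v ≤ (1 - σ) * f v + σ * ∑ w, K v w * V w) : ∑ v, ν v * V v ≤ ∑ v, u v * f v := by
  have h1 : ∑ v, u v * V v ≤ (1 - σ) * ∑ v, u v * f v + σ * ∑ v, u v * ∑ w, K v w * V w := by
    calc ∑ v, u v * V v ≤ ∑ v, u v * ((1 - σ) * f v + σ * ∑ w, K v w * V w) :=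
          sum_le_sum fun v _ => mul_le_mul_of_nonneg_left (hV v) (hu0 v)
      _ = (1 - σ) * ∑ v, u v * f v + σ * ∑ v, u v * ∑ w, K v w * V w := by
          rw [mul_sum, mul_sum, ← sum_add_distrib]
          exact sum_congr rfl fun v _ => by ring
  -- `σ Σ_v u_v (KV)_v = Σ_w (u_w − (1−σ)ν_w) V_w`
  have h2 : σ * ∑ v, u v * ∑ w, K v w * V w = ∑ w, u w * V w - (1 - σ) * ∑ w, ν w * V w := by
    rw [← geomResolvent_sum_swap u V K, mul_sum, mul_sum, ← sum_sub_distrib]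
    refine sum_congr rfl fun w _ => ?_
    have := hu w
    calc σ * ((∑ h, u h * K h w) * V w) = (σ * ∑ h, u h * K h w) * V w := by ring
      _ = (u w - (1 - σ) * ν w) * V w := by rw [this]; ring
      _ = u w * V w - (1 - σ) * (ν w * V w) := by ring
  rw [h2] at h1
  have hσ : 0 < 1 - σ := by linarith
  nlinarith

/-- **SUPER-SOLUTION PRINCIPLE.**  `u ≥ 0` solving `u = (1−σ)ν + σ·uK` with `σ < 1`; if `V ≥ (1−σ)·f + σ·KV` pointwise then `Σ u f ≤ Σ ν V`. [ours] -/
theorem geomResolvent_expect_le_of_supersolution (hσ1 : σ < 1) (hu : ∀ v, u v = (1 - σ) * ν v + σ * ∑ h, u h * K h v) (hu0 : ∀ v, 0 ≤ u v)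
    {f V : S → ℝ} (hV : ∀ v, (1 - σ) * f v + σ * ∑ w, K v w * V w ≤ V v) : ∑ v, u v * f v ≤ ∑ v, ν v * V v := by
  have h := geomResolvent_expect_ge_of_subsolution (f := fun v => -f v) (V := fun v => -V v) hσ1 hu hu0 (fun v => by
    have := hV v
    have e : ∑ w, K v w * -V w = -∑ w, K v w * V w := by rw [← sum_neg_distrib]; exact sum_congr rfl fun w _ => by ring
    rw [e]; linarith)
  simp only [mul_neg, sum_neg_distrib] at h
  linarith

/-- A function bounded below by `c` has `Σ u f ≥ c·Σ ν`. [ours] -/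
theorem geomResolvent_expect_ge_const (hK1 : ∀ a, ∑ b, K a b = 1) (hσ1 : σ < 1) (hu : ∀ v, u v = (1 - σ) * ν v + σ * ∑ h, u h * K h v)
    (hu0 : ∀ v, 0 ≤ u v) {f : S → ℝ} {c : ℝ} (hf : ∀ v, c ≤ f v) : c * ∑ v, ν v ≤ ∑ v, u v * f v := by
  have h := geomResolvent_expect_ge_of_subsolution (V := fun _ => c) hσ1 hu hu0 (f := f) (fun v => by
    rw [← sum_mul, hK1, one_mul]
    have : 0 ≤ (1 - σ) * (f v - c) := mul_nonneg (by linarith) (by linarith [hf v])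
    linarith)
  calc c * ∑ v, ν v = ∑ v, ν v * c := by rw [mul_comm, sum_mul]
    _ ≤ ∑ v, u v * f v := h

/-- A function bounded above by `c` has `Σ u f ≤ c·Σ ν`. [ours] -/
theorem geomResolvent_expect_le_const (hK1 : ∀ a, ∑ b, K a b = 1) (hσ1 : σ < 1) (hu : ∀ v, u v = (1 - σ) * ν v + σ * ∑ h, u h * K h v)
    (hu0 : ∀ v, 0 ≤ u v) {f : S → ℝ} {c : ℝ} (hf : ∀ v, f v ≤ c) : ∑ v, u v * f v ≤ c * ∑ v, ν v := by
  have h := geomResolvent_expect_le_of_supersolution (V := fun _ => c) hσ1 hu hu0 (f := f) (fun v => by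
    rw [← sum_mul, hK1, one_mul]
    have : 0 ≤ (1 - σ) * (c - f v) := mul_nonneg (by linarith) (by linarith [hf v])
    linarith)
  calc ∑ v, u v * f v ≤ ∑ v, ν v * c := h
    _ = c * ∑ v, ν v := by rw [mul_comm, sum_mul]

/-- **DRIFT FORM.**  If `f − Kf ≤ d` pointwise (`d ≥ 0` a constant: each step loses at most `d` in expectation), then
`Σ u f ≥ Σ ν f − (σ/(1−σ))·d·Σ ν` — at most `τ = σ/(1−σ)` expected steps of drift (`0 ≤ σ < 1`, rows of `K` one). [ours] -/
theorem geomResolvent_expect_ge_of_drift (hK1 : ∀ a, ∑ b, K a b = 1) (hσ0 : 0 ≤ σ) (hσ1 : σ < 1)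
    (hu : ∀ v, u v = (1 - σ) * ν v + σ * ∑ h, u h * K h v) (hu0 : ∀ v, 0 ≤ u v) {f : S → ℝ} {d : ℝ}
    (hd : ∀ v, f v - ∑ w, K v w * f w ≤ d) :
    ∑ v, ν v * f v - σ / (1 - σ) * d * ∑ v, ν v ≤ ∑ v, u v * f v := by
  have hσ : 0 < 1 - σ := by linarith
  -- `V = f − β`, `β = σ d/(1−σ)`
  set β : ℝ := σ / (1 - σ) * d with hβ
  have h := geomResolvent_expect_ge_of_subsolution (V := fun v => f v - β) hσ1 hu hu0 (f := f) (fun v => by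
    have e : ∑ w, K v w * (f w - β) = ∑ w, K v w * f w - β := by
      rw [show (∑ w, K v w * (f w - β)) = ∑ w, K v w * f w - ∑ w, K v w * β by
        rw [← sum_sub_distrib]; exact sum_congr rfl fun w _ => by ring, ← sum_mul, hK1, one_mul]
    rw [e]
    -- need: f v − β ≤ (1−σ) f v + σ (Kf v − β) ⟺ σ (f v − Kf v) ≤ (1−σ) β = σ d
    have hσ' : (1 - σ) ≠ 0 := ne_of_gt hσ
    have hβ' : (1 - σ) * β = σ * d := by rw [hβ]; field_simp
    nlinarith [hd v, mul_le_mul_of_nonneg_left (hd v) hσ0, hβ'])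
  have e2 : ∑ v, ν v * (f v - β) = ∑ v, ν v * f v - β * ∑ v, ν v := by
    rw [mul_sum, ← sum_sub_distrib]; exact sum_congr rfl fun v _ => by ring
  rw [e2] at h
  exact h

/-- **Drift form, upper:** if `Kf − f ≤ d` pointwise then `Σ u f ≤ Σ ν f + (σ/(1−σ))·d·Σ ν`. [ours] -/
theorem geomResolvent_expect_le_of_drift (hK1 : ∀ a, ∑ b, K a b = 1) (hσ0 : 0 ≤ σ) (hσ1 : σ < 1)
    (hu : ∀ v, u v = (1 - σ) * ν v + σ * ∑ h, u h * K h v) (hu0 : ∀ v, 0 ≤ u v) {f : S → ℝ} {d : ℝ}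
    (hd : ∀ v, ∑ w, K v w * f w - f v ≤ d) :
    ∑ v, u v * f v ≤ ∑ v, ν v * f v + σ / (1 - σ) * d * ∑ v, ν v := by
  have h := geomResolvent_expect_ge_of_drift (f := fun v => -f v) (d := d) hK1 hσ0 hσ1 hu hu0 (fun v => by
    have e : ∑ w, K v w * -f w = -∑ w, K v w * f w := by rw [← sum_neg_distrib]; exact sum_congr rfl fun w _ => by ring
    rw [e]; linarith [hd v])
  simp only [mul_neg, sum_neg_distrib] at h
  linarith

/-- **Harmonic functions are preserved:** if `Kf = f` pointwise then `Σ u f = Σ ν f`. [ours] -/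
theorem geomResolvent_expect_eq_of_harmonic (hK1 : ∀ a, ∑ b, K a b = 1) (hσ0 : 0 ≤ σ) (hσ1 : σ < 1)
    (hu : ∀ v, u v = (1 - σ) * ν v + σ * ∑ h, u h * K h v) (hu0 : ∀ v, 0 ≤ u v) {f : S → ℝ}
    (hf : ∀ v, ∑ w, K v w * f w = f v) : ∑ v, u v * f v = ∑ v, ν v * f v := by
  have h1 := geomResolvent_expect_ge_of_drift (d := 0) hK1 hσ0 hσ1 hu hu0 (f := f) (fun v => by rw [hf v]; simp)
  have h2 := geomResolvent_expect_le_of_drift (d := 0) hK1 hσ0 hσ1 hu hu0 (f := f) (fun v => by rw [hf v]; simp)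
  simp only [mul_zero, zero_mul, sub_zero, add_zero] at h1 h2
  exact le_antisymm h2 h1

end Resolvent

end Summit.Ventures.LatticeQCDFlow.Scaling
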